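import Summits.ResolutionOfSingularities.ResolutionOfSingularities.Theorems.FrobeniusClosingSteerRadicandChainNonIsolated
import Summits.ResolutionOfSingularities.ResolutionOfSingularities.Theorems.FrobeniusClosingSteerWords06SteeredVocab
import Literature.AlgebraicGeometry.Resolution.AdicCompletionRegular
import HarnessLib

/-!
# Steer / hGW3 kernel debt K-GG3: **(CD0) AT A NON-MAXIMAL PRIME** — `f − B^p ∈ Q²`, `Q ≠ 𝔪` prime ⇒ the radicand ring of `f` is NOT isolated

OURS (campaign res-hironaka, rung L ★L-G4, slot W4.1, crux `Steer` stmt-ResolutionOfSingularities-16345; res-L0-w41-plan-1 RULINGS 185h (2) / 203c /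
205 / 244 (a): kernel debt **K-GG3** of res-L0-w41-tri-1's `v621/KGG-signatures.md` 036f669dd3fa960c — «(CD0) IN THE COMPLETION, abstract-ring copy of
p529051 / ascent p513029»; res-L0-w41-stub-3 g7; consumed BY NAME by res-L0-w41-stub-2's hGW3 assembly map; replaces the role of no printed item; NOT a
statement of the manuscript under review [claim: Hironaka2017, status: under-review]; AI review is weaker than expert review). Theses-free, definition-free.

The statement typed by tri-1 reads `(hreg : IsRegularLocalRing S) [CharP S 2] (Q : Ideal S) [Q.IsPrime] (hQ : Q ≠ maximalIdeal S) (f B : S)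
(h : f − B² ∈ Q²) (hf : ∀ g, f ≠ g²) : ¬ HasIsolatedSingularity (RadicandRing S 2 f)`; the hypothesis `hf` («`f` is not a square») is SUPERFLUOUS and is
dropped here (if `f = g²` the radicand ring is nowhere reduced, a fortiori not isolated — the proof below does not case on it): the prime `Q·S[θ] + (θ − B)`
of `S[θ]/(θ^p − f)` lies over the non-maximal prime `Q`, so it is non-maximal, and its local ring is the regular local ring `S_Q[θ']_{(Q, θ')}` modulo
`θ'^p − (f − B^p)` with `f − B^p ∈ Q² ⊆ 𝔫²` — not regular [Matsumura, Thm. 14.2]. The kernel content is res-D-pv-007/idea-1's (B1)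
`RadicandChain.sub_pow_not_mem_sq_of_isolated` (`…FrobeniusClosingSteerRadicandChainNonIsolated`, p513029 ✓); this file is the `HasIsolatedSingularity` /
`RadicandRing` vocabulary wrapper (idea-1's words of `…Words06SteeredVocab`, namespace `…SwitchingDichotomy.Words` — the ones LEMMA I
`LemmaI.insepStepNotIsolated_holds` and the hGW3 word use; res-L0-w41-stub-1's `SigmaTopLegality` copies are definitionally equal) for an ABSTRACT regular
local ring (the completion `Ŝ`, where CLAIM R's formal curve prime lives), for every prime exponent `p` and for `p = 2`.
[cite: Matsumura1987, Thm. 14.2] [folklore]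
-/

noncomputable section

-- single-problem summit: the doubled namespace component `ResolutionOfSingularities` is forced
set_option linter.dupNamespace false

namespace Summit.ResolutionOfSingularities.ResolutionOfSingularities.Theorems.SwitchingDichotomy.KGG

open IsLocalRing Literature.AlgebraicGeometry.Resolution
open Summit.ResolutionOfSingularities.ResolutionOfSingularities.Theorems.SwitchingDichotomy
open Summit.ResolutionOfSingularities.ResolutionOfSingularities.Theorems.SwitchingDichotomy.Words

/-- **K-GG3, prime exponent `p`**: on a regular local ring `S` of characteristic `p`, if `f − B^p ∈ Q²` for a NON-maximal prime `Q`, then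
`S[θ]/(θ^p − f)` does not have an isolated singularity. [cite: Matsumura1987, Thm. 14.2] [folklore] -/
theorem not_hasIsolatedSingularity_of_sub_pow_mem_sq_prime (p : ℕ) [Fact p.Prime] {S : Type} [CommRing S] [IsLocalRing S]
    (hreg : IsRegularLocalRing S) [CharP S p] (Q : Ideal S) [Q.IsPrime] (hQ : Q ≠ maximalIdeal S) (f B : S) (h : f - B ^ p ∈ Q ^ 2) :
    ¬ HasIsolatedSingularity (RadicandRing S p f) := by
  intro hiso
  haveI := hreg
  haveI : IsRegularRing S := isRegularRing_of_isRegularLocalRing S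
  haveI : IsDomain S := isDomain_of_isRegularLocalRing S
  have hnotmax : ¬ Q.IsMaximal := fun hm => hQ (IsLocalRing.eq_maximalIdeal hm)
  exact RadicandChain.sub_pow_not_mem_sq_of_isolated p f (fun P _ hP => hiso P hP) Q hnotmax B h

/-- **K-GG3** (res-L0-w41-tri-1 `v621/KGG-signatures.md` 036f669dd3fa960c, the superfluous «`f` not a square» hypothesis dropped): on a regular local
ring `S` of characteristic `2`, `f − B² ∈ Q²` for a prime `Q ≠ 𝔪` makes the radicand ring `S[θ]/(θ² − f)` NON-isolated.
[cite: Matsumura1987, Thm. 14.2] [folklore] -/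
theorem not_hasIsolatedSingularity_of_sub_sq_mem_sq {S : Type} [CommRing S] [IsLocalRing S] (hreg : IsRegularLocalRing S) [CharP S 2]
    (Q : Ideal S) [Q.IsPrime] (hQ : Q ≠ maximalIdeal S) (f B : S) (h : f - B ^ 2 ∈ Q ^ 2) :
    ¬ HasIsolatedSingularity (RadicandRing S 2 f) :=
  haveI : Fact (Nat.Prime 2) := ⟨Nat.prime_two⟩
  not_hasIsolatedSingularity_of_sub_pow_mem_sq_prime 2 hreg Q hQ f B h

/-- **K-GG3 with tri-1's redundant hypothesis kept** (literal binder list of the brief, for consumers that typed it so). [cite: Matsumura1987, Thm. 14.2]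
[folklore] -/
theorem not_hasIsolatedSingularity_of_sub_sq_mem_sq' {S : Type} [CommRing S] [IsLocalRing S] (hreg : IsRegularLocalRing S) [CharP S 2]
    (Q : Ideal S) [Q.IsPrime] (hQ : Q ≠ maximalIdeal S) (f B : S) (h : f - B ^ 2 ∈ Q ^ 2) (_hf : ∀ g : S, f ≠ g ^ 2) :
    ¬ HasIsolatedSingularity (RadicandRing S 2 f) :=
  not_hasIsolatedSingularity_of_sub_sq_mem_sq hreg Q hQ f B h

end Summit.ResolutionOfSingularities.ResolutionOfSingularities.Theorems.SwitchingDichotomy.KGG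

end
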